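import Summits.QuantumFields.YangMills.Theorems.UnitScaleTiltProp7CombSymR12OfSiteRowT3
import Literature.MathematicalPhysics.QuantumFieldTheory.Balaban1983to89.BlockAveragingFederbush
import Literature.MathematicalPhysics.QuantumFieldTheory.Balaban1983to89.B11Eq98V0LettersFlat
import HarnessLib

/-!
# `UnitScaleTiltProp7R0OfFrameRowsT3` — THE FRAME-RATIO ROW (R0) DECOUPLES: **`‖log(w_c⁻¹·w_s) − (r_s − r_c)A‖ ≤ 5·(‖w_c − 1‖² + ‖w_s − 1‖²) + ‖w_s − 1 − r_sA‖ + ‖w_c − 1 − r_cA‖`** —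
# the two-tower second-order row (R0) of the (β) door (✓`Prop7CombSymR12OfSiteRow.sum_norm_CmapTw_sub_CmapTwS_le_of_siteRow`, binder `hR0`) is the SUM of the two FIRST-ORDER frame masses
# (F3″-COMB `Φᶜ`, F3″-sym `Φˢ` — both staffed) and of TWO ONE-TOWER second-order remainder rows «REM2ᶜ», «REM2ˢ»; plus the product∕inverse rules for second-order remainders that drive a
# one-tower recursion (route `UnitScaleTilt`, crux K1 «MinimiserStabilityRegPr» stmt-QuantumFields-19200; ★★OWNER ym3-torus-plan g29 RULING №19 (3) «R0-RECURSION FILE := px13 g6»,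
# px16 g5 LOCATE R0 `LOCATE-R0-FRAME-RATIO-px16g5.md` §2 (first refusal waived 05:18:15Z); this file = R0-DOOR, the first brick; def-free, count-neutral).
Cell `ym3-torus` (HUMAN RULING D-0037, YM ladder rung R3 — YM₃ on T³ is a rung, not d = 4, not infinite volume, not a mass gap, not Clay), width seat `ym3-torus-px13` (gen 6).

THE PRINT.  [Balaban1985Averaging] (89)–(92), (97) p. 31–32: the accumulated frames of the block averaging (here TWO of them at one coarse site `y`: print's comb frame `w_c = frameTw W A y` and the
route's symmetric frame `w_s = frameTwS W A y`); (26)–(27) p. 22: `log` of a product of near-unit matrices to second order; [Balaban1985Variational] (44)–(48) p. 285 (the chart remainders begin at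
second order).  No print analogue of the frame RATIO exists (px16 LOCATE §2 (b)); this file is elementary normed-algebra bookkeeping that re-sizes (R0).

WHAT IS PROVED (sorry-free, no definition; `𝔸` any complete normed `ℂ`-algebra in §1, `M₂(ℂ)` at the member in §2):
* §1 [folklore] SECOND-ORDER REMAINDER CALCULUS with arbitrary «linear parts» `a b : 𝔸`: `mul_sub_one_sub_add_eq` (`uv − 1 − (a + b) = (u − 1 − a) + (v − 1 − b) + (u − 1)(v − 1)`) and its norm form;
  `units_inv_sub_one_add_eq` (`u⁻¹ − 1 + a = −(u − 1 − a) + u⁻¹(u − 1)²`) and its norm form under `‖u⁻¹‖ ≤ 1`; ★ `norm_inv_mul_sub_one_sub_le` (`‖u⁻¹v − 1 − (b − a)‖ ≤ ‖u − 1 − a‖ + ‖v − 1 − b‖ +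
  2‖u − 1‖² + ‖u − 1‖·‖v − 1‖`); ★★ `norm_mlog_inv_mul_sub_le` — the title inequality, for `‖u − 1‖, ‖v − 1‖ ≤ 1∕8`, `‖u⁻¹‖ ≤ 1` (lit `FederbushMean.norm_mlog_sub_sub_one_le_of_le`: `‖log X − (X − 1)‖ ≤ s²∕(1−s)`).
* §2 ★★★ `siteRow_of_frameRows` — at the member, px16's per-site row (R0) `‖mlog ↑((frameTw W A y)⁻¹·frameTwS W A y) − (D(frameTwS)(0)A − D(frameTw)(0)A)‖ ≤ ρ y` HOLDS with
  `ρ y := 5·(pc y² + ps y²) + rs y + rc y` under the four displayed pointwise rows `‖↑frameTw − 1‖ ≤ pc y ≤ 1∕8`, `‖↑frameTwS − 1‖ ≤ ps y ≤ 1∕8`, `‖↑frameTwS − 1 − D(frameTwS)(0)A‖ ≤ rs y` («REM2ˢ»),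
  `‖↑frameTw − 1 − D(frameTw)(0)A‖ ≤ rc y` («REM2ᶜ») and `‖↑(frameTw)⁻¹‖ ≤ 1`; ★★★ `sum_siteRow_of_frameRows` — summed: `Σ_y ρ y = 5·(Σ_y pc y² + Σ_y ps y²) + Σ_y rs y + Σ_y rc y`, i.e.
  **(R0) in E2E currency ⟸ Φᶜ_top + Φˢ_top + REM2ˢ + REM2ᶜ**; ★★★ `sum_norm_CmapTw_sub_CmapTwS_le_of_frameRows` — px16's (β) door with `hR0` DISCHARGED into those four rows.
HONEST FRAMING.  Algebra; no estimate of any frame; the rows `pc ps rs rc` are displayed, not proved (Φᶜ: ★routeR-w6 g8 F3″-COMB under `hMcomb`; Φˢ: px16 g5 Φˢ-EXPORT; REM2ˢ∕REM2ᶜ: the one-tower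
second-order recursions — OPEN, sized in the LOCATE memo «R0-RECURSION»); nothing of (β)∕hPA2∕hcoS∕E′∕EX∕the crux K1 is proved; rung R3, not Clay; YM gap NOT proved.  `--supports stmt-QuantumFields-19200 --as helper`.
References: T. Bałaban, CMP 98 (1985) 17–51 [Balaban1985Averaging] ((26)–(27) p.22, (89)–(92) p.31, (97) p.32); CMP 102 (1985) 277–309 [Balaban1985Variational] ((44)–(48) p.285);
CMP 99 (1985) 389–434 [Balaban1985BackgroundPropagators] ((3.14)–(3.15) p.393).
-/

noncomputable section

open scoped BigOperators Matrix.Norms.L2Operator Matrix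

namespace Summit.QuantumFields.YangMills.Theorems.Prop7R0OfFrameRows

open Literature.MathematicalPhysics.QuantumFieldTheory.Balaban1983to89
open Literature.MathematicalPhysics.QuantumFieldTheory.Balaban1983to89.T3ContinuumYM3Torus
open MatrixLog (mlog)
open T3PrintedRegularMinimiser (RegPr)
open FederbushMean (norm_mlog_sub_sub_one_le_of_le)
open B11Eq98V0LettersFlat (norm_inv_sub_one_le)
open Summit.QuantumFields.YangMills.Theorems.Prop7SymAvgTw (frameTw CmapTw)
open Summit.QuantumFields.YangMills.Theorems.Prop7SymAvgTwSym (frameTwS dbarTwS CmapTwS)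
open Summit.QuantumFields.YangMills.Theorems.Prop7CombSymR12OfSiteRow (sum_norm_CmapTw_sub_CmapTwS_le_of_siteRow)

/-! ## §1 Second-order remainder calculus in a normed algebra -/

section Algebra

variable {𝔸 : Type*} [NormedRing 𝔸] [NormedAlgebra ℂ 𝔸] [CompleteSpace 𝔸]

omit [NormedAlgebra ℂ 𝔸] [CompleteSpace 𝔸] in
/-- **PRODUCT RULE FOR SECOND-ORDER REMAINDERS**: `uv − 1 − (a + b) = (u − 1 − a) + (v − 1 − b) + (u − 1)(v − 1)` for arbitrary «linear parts» `a, b`. [folklore] -/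
theorem mul_sub_one_sub_add_eq (u v a b : 𝔸) : u * v - 1 - (a + b) = (u - 1 - a) + (v - 1 - b) + (u - 1) * (v - 1) := by
  noncomm_ring

omit [NormedAlgebra ℂ 𝔸] [CompleteSpace 𝔸] in
/-- Norm form of the product rule: `‖uv − 1 − (a + b)‖ ≤ ‖u − 1 − a‖ + ‖v − 1 − b‖ + ‖u − 1‖·‖v − 1‖`. [folklore] -/
theorem norm_mul_sub_one_sub_add_le (u v a b : 𝔸) : ‖u * v - 1 - (a + b)‖ ≤ ‖u - 1 - a‖ + ‖v - 1 - b‖ + ‖u - 1‖ * ‖v - 1‖ := by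
  rw [mul_sub_one_sub_add_eq]
  exact (norm_add_le _ _).trans (add_le_add ((norm_add_le _ _).trans le_rfl) (norm_mul_le _ _))

omit [NormedAlgebra ℂ 𝔸] [CompleteSpace 𝔸] in
/-- **INVERSE RULE FOR SECOND-ORDER REMAINDERS**: `u⁻¹ − 1 + a = −(u − 1 − a) + u⁻¹(u − 1)²` (the linear part of `u⁻¹` is `−a`). [folklore] -/
theorem units_inv_sub_one_add_eq (u : 𝔸ˣ) (a : 𝔸) :
    ((u⁻¹ : 𝔸ˣ) : 𝔸) - 1 + a = -((u : 𝔸) - 1 - a) + ((u⁻¹ : 𝔸ˣ) : 𝔸) * (((u : 𝔸) - 1) * ((u : 𝔸) - 1)) := by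
  have h : ((u⁻¹ : 𝔸ˣ) : 𝔸) * (u : 𝔸) = 1 := Units.inv_mul u
  -- `u⁻¹(u−1)² = u⁻¹u·u − u⁻¹u − u⁻¹u + u⁻¹ = u − 1 − 1 + u⁻¹`
  calc ((u⁻¹ : 𝔸ˣ) : 𝔸) - 1 + a
      = -((u : 𝔸) - 1 - a) + (((u⁻¹ : 𝔸ˣ) : 𝔸) * (u : 𝔸) * (u : 𝔸) - ((u⁻¹ : 𝔸ˣ) : 𝔸) * (u : 𝔸) - ((u⁻¹ : 𝔸ˣ) : 𝔸) * (u : 𝔸) + ((u⁻¹ : 𝔸ˣ) : 𝔸)) := by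
        rw [h]; noncomm_ring
    _ = -((u : 𝔸) - 1 - a) + ((u⁻¹ : 𝔸ˣ) : 𝔸) * (((u : 𝔸) - 1) * ((u : 𝔸) - 1)) := by noncomm_ring

omit [NormedAlgebra ℂ 𝔸] [CompleteSpace 𝔸] in
/-- Norm form of the inverse rule under `‖u⁻¹‖ ≤ 1` (e.g. `u` unitary): `‖u⁻¹ − 1 + a‖ ≤ ‖u − 1 − a‖ + ‖u − 1‖²`. [folklore] -/
theorem norm_units_inv_sub_one_add_le (u : 𝔸ˣ) (a : 𝔸) (hu : ‖((u⁻¹ : 𝔸ˣ) : 𝔸)‖ ≤ 1) :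
    ‖((u⁻¹ : 𝔸ˣ) : 𝔸) - 1 + a‖ ≤ ‖(u : 𝔸) - 1 - a‖ + ‖(u : 𝔸) - 1‖ ^ 2 := by
  rw [units_inv_sub_one_add_eq]
  refine (norm_add_le _ _).trans (add_le_add (by rw [norm_neg]) ?_)
  calc ‖((u⁻¹ : 𝔸ˣ) : 𝔸) * (((u : 𝔸) - 1) * ((u : 𝔸) - 1))‖
      ≤ ‖((u⁻¹ : 𝔸ˣ) : 𝔸)‖ * (‖(u : 𝔸) - 1‖ * ‖(u : 𝔸) - 1‖) := (norm_mul_le _ _).trans (mul_le_mul_of_nonneg_left (norm_mul_le _ _) (norm_nonneg _))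
    _ ≤ 1 * (‖(u : 𝔸) - 1‖ * ‖(u : 𝔸) - 1‖) := mul_le_mul_of_nonneg_right hu (by positivity)
    _ = ‖(u : 𝔸) - 1‖ ^ 2 := by ring

omit [NormedAlgebra ℂ 𝔸] [CompleteSpace 𝔸] in
/-- ★ **THE SECOND-ORDER REMAINDER OF A FRAME RATIO**: `‖u⁻¹v − 1 − (b − a)‖ ≤ ‖u − 1 − a‖ + ‖v − 1 − b‖ + 2‖u − 1‖² + ‖u − 1‖·‖v − 1‖` under `‖u⁻¹‖ ≤ 1` — product rule at `(u⁻¹, v)` with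
linear parts `(−a, b)`, inverse rule, and lit ✓`B11Eq98V0LettersFlat.norm_inv_sub_one_le` (`‖u⁻¹ − 1‖ ≤ ‖u − 1‖`). [folklore] -/
theorem norm_inv_mul_sub_one_sub_le (u v : 𝔸ˣ) (a b : 𝔸) (hu : ‖((u⁻¹ : 𝔸ˣ) : 𝔸)‖ ≤ 1) :
    ‖((u⁻¹ * v : 𝔸ˣ) : 𝔸) - 1 - (b - a)‖
      ≤ ‖(u : 𝔸) - 1 - a‖ + ‖(v : 𝔸) - 1 - b‖ + 2 * ‖(u : 𝔸) - 1‖ ^ 2 + ‖(u : 𝔸) - 1‖ * ‖(v : 𝔸) - 1‖ := by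
  have e : b - a = -a + b := by abel
  rw [Units.val_mul, e]
  have h1 := norm_mul_sub_one_sub_add_le ((u⁻¹ : 𝔸ˣ) : 𝔸) (v : 𝔸) (-a) b
  have h2 : ‖((u⁻¹ : 𝔸ˣ) : 𝔸) - 1 - -a‖ ≤ ‖(u : 𝔸) - 1 - a‖ + ‖(u : 𝔸) - 1‖ ^ 2 := by
    rw [sub_neg_eq_add]; exact norm_units_inv_sub_one_add_le u a hu
  have h3 : ‖((u⁻¹ : 𝔸ˣ) : 𝔸) - 1‖ * ‖(v : 𝔸) - 1‖ ≤ ‖(u : 𝔸) - 1‖ * ‖(v : 𝔸) - 1‖ :=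
    mul_le_mul_of_nonneg_right (norm_inv_sub_one_le u hu) (norm_nonneg _)
  nlinarith [h1, h2, h3, sq_nonneg ‖(u : 𝔸) - 1‖]

omit [NormedAlgebra ℂ 𝔸] [CompleteSpace 𝔸] in
/-- The ratio's first-order deviation: `‖u⁻¹v − 1‖ ≤ ‖u − 1‖ + ‖v − 1‖` under `‖u⁻¹‖ ≤ 1` (`u⁻¹v − 1 = u⁻¹(v − u)`). [folklore] -/
theorem norm_inv_mul_sub_one_le (u v : 𝔸ˣ) (hu : ‖((u⁻¹ : 𝔸ˣ) : 𝔸)‖ ≤ 1) :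
    ‖((u⁻¹ * v : 𝔸ˣ) : 𝔸) - 1‖ ≤ ‖(u : 𝔸) - 1‖ + ‖(v : 𝔸) - 1‖ := by
  have h : ((u⁻¹ * v : 𝔸ˣ) : 𝔸) - 1 = ((u⁻¹ : 𝔸ˣ) : 𝔸) * (((v : 𝔸) - 1) - ((u : 𝔸) - 1)) := by
    rw [Units.val_mul, mul_sub, mul_sub, mul_sub, Units.inv_mul, mul_one]; abel
  rw [h]
  calc ‖((u⁻¹ : 𝔸ˣ) : 𝔸) * (((v : 𝔸) - 1) - ((u : 𝔸) - 1))‖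
      ≤ 1 * ‖((v : 𝔸) - 1) - ((u : 𝔸) - 1)‖ := (norm_mul_le _ _).trans (mul_le_mul_of_nonneg_right hu (norm_nonneg _))
    _ ≤ ‖(u : 𝔸) - 1‖ + ‖(v : 𝔸) - 1‖ := by rw [one_mul]; exact (norm_sub_le _ _).trans (by rw [add_comm])

/-- ★★ **THE FRAME-RATIO ROW DECOUPLES**: for units `u, v` within `1∕8` of `1`, `‖u⁻¹‖ ≤ 1`, and any «linear parts» `a, b`:
`‖log(u⁻¹v) − (b − a)‖ ≤ 5·(‖u − 1‖² + ‖v − 1‖²) + ‖v − 1 − b‖ + ‖u − 1 − a‖` — `log X = (X − 1) + O(‖X − 1‖²)` (lit `FederbushMean.norm_mlog_sub_sub_one_le_of_le`, `‖X − 1‖ ≤ ¼`) and the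
ratio's second-order remainder. [cite: Balaban1985Averaging, (26)-(27) p.22] -/
theorem norm_mlog_inv_mul_sub_le (u v : 𝔸ˣ) (a b : 𝔸) (hu : ‖((u⁻¹ : 𝔸ˣ) : 𝔸)‖ ≤ 1)
    (hu8 : ‖(u : 𝔸) - 1‖ ≤ 1 / 8) (hv8 : ‖(v : 𝔸) - 1‖ ≤ 1 / 8) :
    ‖mlog ((u⁻¹ * v : 𝔸ˣ) : 𝔸) - (b - a)‖
      ≤ 5 * (‖(u : 𝔸) - 1‖ ^ 2 + ‖(v : 𝔸) - 1‖ ^ 2) + ‖(v : 𝔸) - 1 - b‖ + ‖(u : 𝔸) - 1 - a‖ := by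
  set X : 𝔸 := ((u⁻¹ * v : 𝔸ˣ) : 𝔸) with hX
  set p : ℝ := ‖(u : 𝔸) - 1‖ with hp
  set q : ℝ := ‖(v : 𝔸) - 1‖ with hq
  have hp0 : 0 ≤ p := norm_nonneg _
  have hq0 : 0 ≤ q := norm_nonneg _
  have hX1 : ‖X - 1‖ ≤ p + q := norm_inv_mul_sub_one_le u v hu
  have hpq : p + q ≤ 1 / 4 := by linarith
  -- `‖log X − (X − 1)‖ ≤ (p+q)²∕(1−(p+q)) ≤ (4∕3)(p+q)²`
  have hlog : ‖mlog X - (X - 1)‖ ≤ (p + q) / (1 - (p + q)) * (p + q) := norm_mlog_sub_sub_one_le_of_le hX1 (by linarith)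
  have hlog' : ‖mlog X - (X - 1)‖ ≤ 4 / 3 * (p + q) ^ 2 := by
    refine hlog.trans ?_
    have h34 : (3 : ℝ) / 4 ≤ 1 - (p + q) := by linarith
    have : (p + q) / (1 - (p + q)) ≤ (p + q) / (3 / 4) := div_le_div_of_nonneg_left (by positivity) (by norm_num) h34
    nlinarith [this]
  have hrem := norm_inv_mul_sub_one_sub_le u v a b hu
  have htri : ‖mlog X - (b - a)‖ ≤ ‖mlog X - (X - 1)‖ + ‖X - 1 - (b - a)‖ := by
    have := norm_add_le (mlog X - (X - 1)) (X - 1 - (b - a))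
    rwa [show mlog X - (X - 1) + (X - 1 - (b - a)) = mlog X - (b - a) by abel] at this
  nlinarith [htri, hlog', hrem, mul_nonneg hp0 hq0, sq_nonneg (p - q)]

end Algebra

/-! ## §2 ★★★ (R0) at the member ⟸ four pointwise frame rows; px16's (β) door with `hR0` discharged -/

section Member

variable (F : T3Family) {n K : ℕ} (h : n ≤ K)

/-- ★★★ **(R0) HOLDS WITH `ρ y := 5·(pc y² + ps y²) + rs y + rc y`** under the displayed pointwise rows: the frame sups `‖↑frameTw − 1‖ ≤ pc y ≤ 1∕8`, `‖↑frameTwS − 1‖ ≤ ps y ≤ 1∕8`, unitarity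
`‖↑(frameTw)⁻¹‖ ≤ 1`, and the ONE-TOWER second-order remainder rows «REM2ˢ» `‖↑frameTwS − 1 − D(frameTwS)(0)A‖ ≤ rs y`, «REM2ᶜ» `‖↑frameTw − 1 − D(frameTw)(0)A‖ ≤ rc y`.
[cite: Balaban1985Averaging, (89)-(92) p.31, (97) p.32, (26)-(27) p.22; Balaban1985Variational, (44)-(48) p.285] -/
theorem siteRow_of_frameRows (W : GaugeField (F.P K) 0 (Matrix.specialUnitaryGroup (Fin 2) ℂ)) (A : PBond (F.P K) 0 → Matrix (Fin 2) (Fin 2) ℂ)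
    (pc ps rs rc : Site (F.P n) 0 → ℝ)
    (hpc : ∀ y, ‖((frameTw F n K h W A y : (Matrix (Fin 2) (Fin 2) ℂ)ˣ) : Matrix (Fin 2) (Fin 2) ℂ) - 1‖ ≤ pc y) (hpc8 : ∀ y, pc y ≤ 1 / 8)
    (hps : ∀ y, ‖((frameTwS F n K h W A y : (Matrix (Fin 2) (Fin 2) ℂ)ˣ) : Matrix (Fin 2) (Fin 2) ℂ) - 1‖ ≤ ps y) (hps8 : ∀ y, ps y ≤ 1 / 8)
    (hcU : ∀ y, ‖(((frameTw F n K h W A y)⁻¹ : (Matrix (Fin 2) (Fin 2) ℂ)ˣ) : Matrix (Fin 2) (Fin 2) ℂ)‖ ≤ 1)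
    (hrs : ∀ y, ‖((frameTwS F n K h W A y : (Matrix (Fin 2) (Fin 2) ℂ)ˣ) : Matrix (Fin 2) (Fin 2) ℂ) - 1
        - fderiv ℂ (fun A : PBond (F.P K) 0 → Matrix (Fin 2) (Fin 2) ℂ => ((frameTwS F n K h W A y : (Matrix (Fin 2) (Fin 2) ℂ)ˣ) : Matrix (Fin 2) (Fin 2) ℂ)) 0 A‖ ≤ rs y)
    (hrc : ∀ y, ‖((frameTw F n K h W A y : (Matrix (Fin 2) (Fin 2) ℂ)ˣ) : Matrix (Fin 2) (Fin 2) ℂ) - 1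
        - fderiv ℂ (fun A : PBond (F.P K) 0 → Matrix (Fin 2) (Fin 2) ℂ => ((frameTw F n K h W A y : (Matrix (Fin 2) (Fin 2) ℂ)ˣ) : Matrix (Fin 2) (Fin 2) ℂ)) 0 A‖ ≤ rc y)
    (y : Site (F.P n) 0) :
    ‖mlog ((((frameTw F n K h W A y)⁻¹ * frameTwS F n K h W A y : (Matrix (Fin 2) (Fin 2) ℂ)ˣ) : Matrix (Fin 2) (Fin 2) ℂ))
        - (fderiv ℂ (fun A : PBond (F.P K) 0 → Matrix (Fin 2) (Fin 2) ℂ => ((frameTwS F n K h W A y : (Matrix (Fin 2) (Fin 2) ℂ)ˣ) : Matrix (Fin 2) (Fin 2) ℂ)) 0 A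
            - fderiv ℂ (fun A : PBond (F.P K) 0 → Matrix (Fin 2) (Fin 2) ℂ => ((frameTw F n K h W A y : (Matrix (Fin 2) (Fin 2) ℂ)ˣ) : Matrix (Fin 2) (Fin 2) ℂ)) 0 A)‖
      ≤ 5 * (pc y ^ 2 + ps y ^ 2) + rs y + rc y := by
  have hb := norm_mlog_inv_mul_sub_le (frameTw F n K h W A y) (frameTwS F n K h W A y)
    (fderiv ℂ (fun A : PBond (F.P K) 0 → Matrix (Fin 2) (Fin 2) ℂ => ((frameTw F n K h W A y : (Matrix (Fin 2) (Fin 2) ℂ)ˣ) : Matrix (Fin 2) (Fin 2) ℂ)) 0 A)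
    (fderiv ℂ (fun A : PBond (F.P K) 0 → Matrix (Fin 2) (Fin 2) ℂ => ((frameTwS F n K h W A y : (Matrix (Fin 2) (Fin 2) ℂ)ˣ) : Matrix (Fin 2) (Fin 2) ℂ)) 0 A)
    (hcU y) ((hpc y).trans (hpc8 y)) ((hps y).trans (hps8 y))
  have h1 : ‖((frameTw F n K h W A y : (Matrix (Fin 2) (Fin 2) ℂ)ˣ) : Matrix (Fin 2) (Fin 2) ℂ) - 1‖ ^ 2 ≤ pc y ^ 2 :=
    pow_le_pow_left₀ (norm_nonneg _) (hpc y) 2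
  have h2 : ‖((frameTwS F n K h W A y : (Matrix (Fin 2) (Fin 2) ℂ)ˣ) : Matrix (Fin 2) (Fin 2) ℂ) - 1‖ ^ 2 ≤ ps y ^ 2 :=
    pow_le_pow_left₀ (norm_nonneg _) (hps y) 2
  linarith [hb, h1, h2, hrs y, hrc y]

/-- ★★★ **(R0) SUMMED: `Σ_y ρ y = 5·(Φᶜ + Φˢ) + Σ_y rs y + Σ_y rc y`** with `Φᶜ := Σ_y pc y²`, `Φˢ := Σ_y ps y²` — (R0) in E2E currency is the sum of the two first-order FRAME MASSES (F3″-COMB, F3″-sym) and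
the two one-tower second-order remainder masses «REM2ˢ», «REM2ᶜ». [cite: Balaban1985Averaging, (97) p.32; Balaban1985Variational, (44)-(48) p.285] -/
theorem sum_siteRow_of_frameRows (pc ps rs rc : Site (F.P n) 0 → ℝ) :
    ∑ y : Site (F.P n) 0, (5 * (pc y ^ 2 + ps y ^ 2) + rs y + rc y)
      = 5 * (∑ y : Site (F.P n) 0, pc y ^ 2 + ∑ y : Site (F.P n) 0, ps y ^ 2) + ∑ y : Site (F.P n) 0, rs y + ∑ y : Site (F.P n) 0, rc y := by
  simp only [Finset.sum_add_distrib, Finset.mul_sum, mul_add]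

/-- ★★★ **THE (β) DOOR WITH (R0) DISCHARGED INTO FOUR FRAME ROWS**: px16 g5's ✓`sum_norm_CmapTw_sub_CmapTwS_le_of_siteRow` at `ρ y := 5·(pc y² + ps y²) + rs y + rc y` —
`Σ_c ‖C^{tw}(A)(c) − C^{twS}(A)(c)‖ ≤ 30·(Φᶜ + Φˢ) + 6·(Σ_y rs y + Σ_y rc y) + Σ_c [4(p c₋ + z c)² + 4(p c₋ + z c + p c₋·z c + 2p c₊)²]`.  DISPLAYED: `RegPr`, the LEG windows, `A`
skew-adjoint traceless, (Rp)(Rz), the frame sups `pc ps ≤ 1∕8`, `‖↑(frameTw)⁻¹‖ ≤ 1`, «REM2ˢ» `rs`, «REM2ᶜ» `rc`. [cite: Balaban1985Averaging, (26)-(27) p.22, (89)-(92) p.31; Balaban1985Variational, (44)-(48) p.285] -/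
theorem sum_norm_CmapTw_sub_CmapTwS_le_of_frameRows {ε₀ : ℝ} (hε₀ : 0 < ε₀) (hε : 10 ^ 10 * (F.L : ℝ) ^ 6 * ε₀ ≤ 1) (hε12 : 10 ^ 12 * (F.L : ℝ) ^ 3 * ε₀ ≤ 1)
    (W : GaugeField (F.P K) 0 (Matrix.specialUnitaryGroup (Fin 2) ℂ)) (hreg : RegPr F n K ε₀ W)
    (A : PBond (F.P K) 0 → Matrix (Fin 2) (Fin 2) ℂ) (hA : ∀ b, A b ∈ skewAdjoint (Matrix (Fin 2) (Fin 2) ℂ)) (htr : ∀ b, (A b).trace = 0)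
    (p : Site (F.P n) 0 → ℝ) (z : PBond (F.P n) 0 → ℝ)
    (hp : ∀ y, ‖(((frameTw F n K h W A y)⁻¹ * frameTwS F n K h W A y : (Matrix (Fin 2) (Fin 2) ℂ)ˣ) : Matrix (Fin 2) (Fin 2) ℂ) - 1‖ ≤ p y)
    (hz : ∀ c, ‖((dbarTwS F n K h W A c : (Matrix (Fin 2) (Fin 2) ℂ)ˣ) : Matrix (Fin 2) (Fin 2) ℂ) - 1‖ ≤ z c)
    (hp' : ∀ y, p y ≤ 1 / 60) (hz' : ∀ c, z c ≤ 1 / 30)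
    (pc ps rs rc : Site (F.P n) 0 → ℝ)
    (hpc : ∀ y, ‖((frameTw F n K h W A y : (Matrix (Fin 2) (Fin 2) ℂ)ˣ) : Matrix (Fin 2) (Fin 2) ℂ) - 1‖ ≤ pc y) (hpc8 : ∀ y, pc y ≤ 1 / 8)
    (hps : ∀ y, ‖((frameTwS F n K h W A y : (Matrix (Fin 2) (Fin 2) ℂ)ˣ) : Matrix (Fin 2) (Fin 2) ℂ) - 1‖ ≤ ps y) (hps8 : ∀ y, ps y ≤ 1 / 8)
    (hcU : ∀ y, ‖(((frameTw F n K h W A y)⁻¹ : (Matrix (Fin 2) (Fin 2) ℂ)ˣ) : Matrix (Fin 2) (Fin 2) ℂ)‖ ≤ 1)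
    (hrs : ∀ y, ‖((frameTwS F n K h W A y : (Matrix (Fin 2) (Fin 2) ℂ)ˣ) : Matrix (Fin 2) (Fin 2) ℂ) - 1
        - fderiv ℂ (fun A : PBond (F.P K) 0 → Matrix (Fin 2) (Fin 2) ℂ => ((frameTwS F n K h W A y : (Matrix (Fin 2) (Fin 2) ℂ)ˣ) : Matrix (Fin 2) (Fin 2) ℂ)) 0 A‖ ≤ rs y)
    (hrc : ∀ y, ‖((frameTw F n K h W A y : (Matrix (Fin 2) (Fin 2) ℂ)ˣ) : Matrix (Fin 2) (Fin 2) ℂ) - 1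
        - fderiv ℂ (fun A : PBond (F.P K) 0 → Matrix (Fin 2) (Fin 2) ℂ => ((frameTw F n K h W A y : (Matrix (Fin 2) (Fin 2) ℂ)ˣ) : Matrix (Fin 2) (Fin 2) ℂ)) 0 A‖ ≤ rc y) :
    ∑ c : PBond (F.P n) 0, ‖CmapTw F n K h W A c - CmapTwS F n K h W A c‖ ≤
      30 * (∑ y : Site (F.P n) 0, pc y ^ 2 + ∑ y : Site (F.P n) 0, ps y ^ 2) + 6 * (∑ y : Site (F.P n) 0, rs y + ∑ y : Site (F.P n) 0, rc y)
        + ∑ c : PBond (F.P n) 0, (4 * (p c.src + z c) ^ 2 + 4 * (p c.src + z c + p c.src * z c + 2 * p c.tgt) ^ 2) := by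
  have hdoor := sum_norm_CmapTw_sub_CmapTwS_le_of_siteRow F h hε₀ hε hε12 W hreg A hA htr p z hp hz hp' hz'
    (fun y => 5 * (pc y ^ 2 + ps y ^ 2) + rs y + rc y) (siteRow_of_frameRows F h W A pc ps rs rc hpc hpc8 hps hps8 hcU hrs hrc)
  rw [sum_siteRow_of_frameRows] at hdoor
  linarith [hdoor]

end Member

end Summit.QuantumFields.YangMills.Theorems.Prop7R0OfFrameRows

end
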